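import Literature.MathematicalPhysics.QuantumFieldTheory.Balaban1983to89.B14StarSet
import Literature.MathematicalPhysics.QuantumFieldTheory.Balaban1983to89.B16TstarCount

/-!
# `Balaban1983to89.B14StarSetBlocks` — [Balaban1988Convergent] (1.9) p. 247 ON PRINT'S OWN INSTANCE: the starred bond
# set `X* = X ∖ {b₀(c) : c ∈ X^{(1)}}` for a union of unit blocks `X` of the periodic lattice, with the EXPLICIT
# representative bond `b₀(c)` of the tree (`B16TstarCount.b0`), its hypotheses discharged

statement-level skeleton of published theorems with citation tags; proofs where landed; nothing here is a
claim about the Yang–Mills mass gap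

CITATION HEADER (lean-in-tree rule).  Source: T. Bałaban, *Convergent renormalization expansions for lattice gauge
theories*, Commun. Math. Phys. **119**, 243–285 (1988), doi:10.1007/bf01217741 [Balaban1988Convergent] (cell paper
B14 = "[III]"; held `paper:balaban1988-cmp119-convergent-renormalization`, journal page = PDF page + 242; p. 247 read on
the x2 render `…-p005-x2.png` and the text layer `p0005.txt`); the bond `b₀(c)` is [Balaban1985UV3] p. 260 (after
(17); cell paper B10 = [III]'s ref. [16]) = [Balaban1987RG1] p. 267.  Mega-formalization `lit-balaban`, unit
`lit-balaban-r11` (CMP 119), SKELETON row B14.Eq1.9 (r11 gen 1 `B14StarSet`, p238827: `star XB X1 b₀ := XB ∖ b₀(X1)`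
over an ABSTRACT representative map `b₀ : C → B`).

THE PRINTED TEXT (p. 247 [PDF 5], verbatim): *"The superscript * used in (1.8) means that we take the set of all bonds
with at least one end-point belonging to □′^{∼2}, except the bonds b₀(c) for c, such that at least one end-point
belongs to (□′^{∼2})^{(1)}. More generally, for a set X, which is a union of unit blocks, we define
X* = X ∖ {b₀(c) : c ∈ X^{(1)}}. (1.9)"*

WHAT THIS FILE ADDS (theorems + three set-builders with bodies; no named fact).  The tree already holds print's own
`b₀` CONCRETELY: on the periodic lattice `(ℤ/n)ᵈ`, `n = L·m`, blocked into `L`-cubes of offset `h` (block map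
`B16TstarCount.blk`), `B16TstarCount.b0 L n h c` is THE bond of the coarse bond `c` crossing from `B(c₋)` into `B(c₊)`
(`b0_containedIn`, `b0_mem_corridor`, uniqueness `eq_b0_of_mem_corridor`, injectivity through `b0Spec_torus`; pre-cell,
pub-balaban pv24).  Here r11's abstract (1.9) is IDENTIFIED with that instance:
* §1 (pv24's abstract blocked lattice `blk`, `b0` with `B0Spec`): `star univ univ b0 = B16TstarCount.starBonds b0` —
  (1.9) for `X` = the whole lattice is pv24's `Ω₁*` of p. 249 (`star_univ_univ`, `rfl`); the count
  `|X*| = |X| − |X^{(1)}|` of r11's `card_star_of_injOn` with its injectivity hypothesis DISCHARGED by `B0Spec`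
  (`card_star_of_b0Spec`).
* §2 (the periodic lattice): for a union of unit blocks `X`, given by its set of blocks `Y` (coarse sites), the two bond
  sets print names in the sentence before (1.9) — `touch L h Y` = *"all bonds with at least one end-point belonging to"*
  `X`, `touchC Y` = the coarse bonds *"c, such that at least one end-point belongs to"* `X^{(1)}` — and
  `starBlocks L h Y := star (touch L h Y) (touchC Y) (b0 L n h)` = `X*`; PROVED: every removed `b₀(c)` IS a bond of `X`
  (`image_b0_touchC_subset`, from `blk_b0_start`/`blk_b0_end`: `b₀(c)₋ ∈ B(c₋)`, `b₀(c)₊ ∈ B(c₊)`) — r11's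
  hypothesis `hsub` discharged —, hence `|X*| = |X| − |X^{(1)}|` unconditionally (`card_starBlocks`), membership
  (`mem_starBlocks`), `b₀(c) ∉ X*` (`b0_not_mem_starBlocks`), and `X = T` recovers `Ω₁*` (`starBlocks_univ`).
-/

namespace Literature.MathematicalPhysics.QuantumFieldTheory.Balaban1983to89.B14.StarSetBlocks

open Finset
open Literature.MathematicalPhysics.QuantumFieldTheory.Balaban1983to89
open Literature.MathematicalPhysics.QuantumFieldTheory.Balaban1983to89.B16TstarCount
open Literature.MathematicalPhysics.QuantumFieldTheory.Balaban1983to89.B14.StarSet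

/-! ## §1  The abstract blocked lattice of `B16TstarCount`: whole-lattice instance and the discharged count -/

section Abstract

variable {Site CSite : Type*} {d : ℕ} [DecidableEq Site] {blk : Site → CSite} {b0 : Bond CSite d → Bond Site d}

/-- **(1.9) for `X` = the whole lattice is `Ω₁*` of p. 249**: r11's `star` at `XB = X1 = univ` is, by `rfl`, pv24's
`B16TstarCount.starBonds` (*"Ω₁* = Ω₁∖{b₀(c) : c ∈ Ω₁^{(1)}}"*). [cite: Balaban1988Convergent, (1.9) p.247, p.249] -/
theorem star_univ_univ [Fintype Site] [Fintype CSite] :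
    star (univ : Finset (Bond Site d)) (univ : Finset (Bond CSite d)) b0 = starBonds b0 := rfl

/-- The p. 249 count `|X*| = |X| − |X^{(1)}|` of r11's `card_star_of_injOn` with the injectivity of `c ↦ b₀(c)`
DISCHARGED by pv24's reading `B0Spec` of the printed `b₀` (`B0Spec.injective`); only `{b₀(c) : c ∈ X^{(1)}} ⊆ X`
remains, discharged in §2 for unions of blocks. [cite: Balaban1988Convergent, p.249, (1.9) p.247] -/
theorem card_star_of_b0Spec (hb : B0Spec blk b0) (XB : Finset (Bond Site d)) (X1 : Finset (Bond CSite d))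
    (hsub : X1.image b0 ⊆ XB) : (star XB X1 b0).card = XB.card - X1.card :=
  card_star_of_injOn XB X1 b0 hsub hb.injective.injOn

/-- Whole lattice: `|T*| = |bonds of T| − |bonds of T^{(1)}|` with NO hypothesis left beyond `B0Spec`.
[cite: Balaban1988Convergent, p.249, (1.9) p.247] -/
theorem card_star_univ_univ [Fintype Site] [Fintype CSite] (hb : B0Spec blk b0) :
    (star (univ : Finset (Bond Site d)) (univ : Finset (Bond CSite d)) b0).card =
      Fintype.card (Bond Site d) - Fintype.card (Bond CSite d) := by
  rw [card_star_of_b0Spec hb _ _ (subset_univ _), card_univ, card_univ]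

end Abstract

/-! ## §2  The periodic lattice `(ℤ/n)ᵈ`, `n = L·m`, with pv24's explicit `b₀`: `X*` for a union of unit blocks -/

section Torus

variable {d n m : ℕ}

/-- For a union of unit blocks `X = ⋃_{y ∈ Y} B(y)` (given by its set of blocks `Y ⊆ T^{(1)}`): the bond set print
attaches to `X` in the sentence before (1.9) — *"the set of all bonds with at least one end-point belonging to"* `X`
(`b = ⟨x, x + e_μ⟩`, block map `B16TstarCount.blk L m h`). [cite: Balaban1988Convergent, (1.9) p.247] -/
def touch [NeZero n] (L h : ℕ) (Y : Finset (Fin d → ZMod m)) : Finset (Bond (Fin d → ZMod n) d) :=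
  univ.filter fun b => blk L m h b.1 ∈ Y ∨ blk L m h (b.1 + fUnit n b.2) ∈ Y

/-- The coarse bonds of `X^{(1)}` in the same sentence: *"c, such that at least one end-point belongs to"* `X^{(1)}`
(`c = ⟨y, y + e_μ⟩` a bond of `T^{(1)}`). [cite: Balaban1988Convergent, (1.9) p.247] -/
def touchC [NeZero m] (Y : Finset (Fin d → ZMod m)) : Finset (Bond (Fin d → ZMod m) d) :=
  univ.filter fun c => c.1 ∈ Y ∨ c.1 + cUnit m c.2 ∈ Y

/-- Membership in `touch`. [cite: Balaban1988Convergent, (1.9) p.247] -/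
theorem mem_touch [NeZero n] {L h : ℕ} {Y : Finset (Fin d → ZMod m)} {b : Bond (Fin d → ZMod n) d} :
    b ∈ touch L h Y ↔ blk L m h b.1 ∈ Y ∨ blk L m h (b.1 + fUnit n b.2) ∈ Y := by
  simp [touch]

/-- Membership in `touchC`. [cite: Balaban1988Convergent, (1.9) p.247] -/
theorem mem_touchC [NeZero m] {Y : Finset (Fin d → ZMod m)} {c : Bond (Fin d → ZMod m) d} :
    c ∈ touchC Y ↔ c.1 ∈ Y ∨ c.1 + cUnit m c.2 ∈ Y := by
  simp [touchC]

variable [NeZero n] [NeZero m]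

/-- **(1.9) on print's instance**: `X* = X ∖ {b₀(c) : c ∈ X^{(1)}}` for the union of unit blocks `X` with block set
`Y`, `b₀` = pv24's explicit `B16TstarCount.b0 L n h` — r11's abstract `star` fed with print's own objects.
[cite: Balaban1988Convergent, (1.9) p.247] -/
def starBlocks (L h : ℕ) (Y : Finset (Fin d → ZMod m)) : Finset (Bond (Fin d → ZMod n) d) :=
  star (touch L h Y) (touchC Y) (b0 L n h)

/-- `X*` unfolds to r11's `star`. [cite: Balaban1988Convergent, (1.9) p.247] -/
theorem starBlocks_eq (L h : ℕ) (Y : Finset (Fin d → ZMod m)) :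
    starBlocks (n := n) L h Y = star (touch L h Y) (touchC Y) (b0 L n h) := rfl

/-- **Every removed bond is a bond of `X`** (r11's hypothesis `hsub`, DISCHARGED): if `c` has an end-point in
`X^{(1)}` then `b₀(c)` has an end-point in `X`, because `b₀(c)₋ ∈ B(c₋)` and `b₀(c)₊ ∈ B(c₊)` (pv24's
`blk_b0_start`, `blk_b0_end`; `n = L·m`, offset `h < L`). [cite: Balaban1988Convergent, (1.9) p.247] -/
theorem image_b0_touchC_subset {L h : ℕ} (hn : n = L * m) (hh : h < L) (Y : Finset (Fin d → ZMod m)) :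
    (touchC Y).image (b0 L n h) ⊆ touch (n := n) L h Y := by
  intro b hb
  rw [mem_image] at hb
  obtain ⟨c, hc, rfl⟩ := hb
  rw [mem_touchC] at hc
  rw [mem_touch]
  have h1 := blk_b0_start (d := d) L h hn hh c
  have h2 := blk_b0_end (d := d) L h hn hh c
  have hdir : (b0 L n h c).2 = c.2 := b0_dir L n h c
  rw [hdir, h1, h2]
  exact hc

/-- Membership in `X*`: a bond with an end-point in `X` which is no `b₀(c)`, `c` with an end-point in `X^{(1)}`.
[cite: Balaban1988Convergent, (1.9) p.247] -/
theorem mem_starBlocks {L h : ℕ} {Y : Finset (Fin d → ZMod m)} {b : Bond (Fin d → ZMod n) d} :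
    b ∈ starBlocks L h Y ↔
      (blk L m h b.1 ∈ Y ∨ blk L m h (b.1 + fUnit n b.2) ∈ Y) ∧
        ∀ c : Bond (Fin d → ZMod m) d, (c.1 ∈ Y ∨ c.1 + cUnit m c.2 ∈ Y) → b0 L n h c ≠ b := by
  rw [starBlocks_eq, mem_star, mem_touch]
  constructor
  · rintro ⟨h1, h2⟩
    exact ⟨h1, fun c hc => h2 c (mem_touchC.mpr hc)⟩
  · rintro ⟨h1, h2⟩
    exact ⟨h1, fun c hc => h2 c (mem_touchC.mp hc)⟩

/-- `b₀(c) ∉ X*` for every coarse bond `c` with an end-point in `X^{(1)}` (p. 249: these are the dependent variables).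
[cite: Balaban1988Convergent, (1.9) p.247, p.249] -/
theorem b0_not_mem_starBlocks {L h : ℕ} {Y : Finset (Fin d → ZMod m)} {c : Bond (Fin d → ZMod m) d}
    (hc : c ∈ touchC Y) : b0 L n h c ∉ starBlocks (n := n) L h Y :=
  b0_not_mem_star _ _ _ hc

/-- `X* ⊆ X` (as bond sets). [cite: Balaban1988Convergent, (1.9) p.247] -/
theorem starBlocks_subset (L h : ℕ) (Y : Finset (Fin d → ZMod m)) :
    starBlocks (n := n) L h Y ⊆ touch L h Y :=
  star_subset _ _ _

/-- **The count, unconditionally**: `|X*| = |X| − |X^{(1)}|` (bond sets of the printed sentence) on the periodic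
lattice with `n = L·m`, `h < L` — r11's `card_star_of_injOn` with BOTH hypotheses discharged (`hsub` by
`image_b0_touchC_subset`, injectivity by pv24's `b0Spec_torus`). [cite: Balaban1988Convergent, p.249, (1.9) p.247] -/
theorem card_starBlocks {L h : ℕ} (hn : n = L * m) (hh : h < L) (Y : Finset (Fin d → ZMod m)) :
    (starBlocks (n := n) L h Y).card = (touch (n := n) L h Y).card - (touchC Y).card :=
  card_star_of_b0Spec (b0Spec_torus (d := d) L h hn hh) _ _ (image_b0_touchC_subset hn hh Y)

/-- The same with the removed bonds counted: `|X*| + |X^{(1)}| = |X|`. [cite: Balaban1988Convergent, p.249, (1.9) p.247] -/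
theorem card_starBlocks_add {L h : ℕ} (hn : n = L * m) (hh : h < L) (Y : Finset (Fin d → ZMod m)) :
    (starBlocks (n := n) L h Y).card + (touchC Y).card = (touch (n := n) L h Y).card := by
  have hadd := card_star_add (touch (n := n) L h Y) (touchC Y) (b0 L n h) (image_b0_touchC_subset hn hh Y)
  rwa [card_image_of_injective _ (b0Spec_torus (d := d) L h hn hh).injective] at hadd

/-- `X = T` (every block): the bond sets are everything and `X*` is pv24's `Ω₁*` (`B16TstarCount.starBonds`), whose
count `d·nᵈ − d·mᵈ` is `card_starBonds_torus` there. [cite: Balaban1988Convergent, (1.9) p.247, p.249] -/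
theorem starBlocks_univ (L h : ℕ) :
    starBlocks (n := n) L h (univ : Finset (Fin d → ZMod m)) = starBonds (b0 (d := d) (m := m) L n h) := by
  have ht : touch (n := n) L h (univ : Finset (Fin d → ZMod m)) = univ := by
    ext b
    simp [touch]
  have hc : touchC (univ : Finset (Fin d → ZMod m)) = (univ : Finset (Bond (Fin d → ZMod m) d)) := by
    ext c
    simp [touchC]
  rw [starBlocks_eq, ht, hc, star_univ_univ]

end Torus

end Literature.MathematicalPhysics.QuantumFieldTheory.Balaban1983to89.B14.StarSetBlocks
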